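import Summits.Ventures.YMGap.RobustBall.BoundaryDecayBall
import Summits.Ventures.YMGap.RobustBall.OneStateTailTrivial
import Summits.Ventures.YMGap.RobustBall.LocalPerturbationDecay
import HarnessLib

/-!
# Venture statement — YMGap (cell `pub-ymgap`) — CONJUNCT BODIES T49, T50 (track Y2 / Wilson action at strong coupling: ONE STATE AT A RATE) (seat p3-g6)

STATUS: STAGED for the lead's V21 booking (bus 2026-08-23T16:16Z; «V21 not before v1.10 is indexed» — `YMGapStatementV1_10` is OF RECORD since
p367131 1ed95d0d59df). First of two V21 block files (400-line cap); the second, `StatementConjunctsV21B.lean`, carries T51–T54. The index entry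
`YMGapStatementV1_11 := YMGapStatementV1_10 ∧ T49 ∧ T50 ∧ T51 ∧ T52 ∧ T53 ∧ T54` (the booked subset) is appended to `StatementIndex.lean` (PLAN R215)
after both block files land. Texts: seat ds-3 g12's OWN candidate texts (`HOME/ds/ds3/lean/g12/texts/V1XConjunctsDS3g12*.lean`, PART A → T49,
PART C / E → T50) VERBATIM — only the decl names change (`T_X` → `T49x_X` / `T50x_X`) and the consolidating conjunctions `T49_…`, `T50_…` are p3's.

HONEST FRAMING. WHAT THIS IS: bodies `Tk_… : Prop` + witnesses `Tk_…_holds`, kernel-checked with NO hypothesis, closing by TREE constants only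
(`RobustBall/BoundaryDecayBall.lean` 756783df52e2, `OneStateTailTrivial.lean` c4c520316ab1,
`LocalPerturbationDecay.lean` 4475a7856e33). STRONG-COUPLING LATTICE statements about `SU(N)` lattice Yang–Mills with the Wilson action and about members of the
cell's typed perturbation balls (track Y2): quantitative versions of T40 (one state from every boundary condition) — the RATE at which the boundary condition is
forgotten — plus tail triviality / ergodicity / locality of the one state. Every rate / window / radius is where a Dobrushin-type BOUND closes (a door artefact),
not a physical quantity or transition. WHAT THIS IS NOT: nothing about the crossover, scaling, a continuum limit, reflection positivity, spectra, or the Yang–Mills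
Millennium problem.
-/

noncomputable section

namespace Summit.Ventures.YMGap

section T49sec

open MeasureTheory Filter Topology
open scoped NNReal
open Literature.Probability.LatticeModels hiding configShift configShift_apply
open Literature.MathematicalPhysics.QuantumLattice (fundamentalRep ZdEdge LGConfig ymSpecification ymGibbsMeasures)
open Literature.MathematicalPhysics.QuantumFieldTheory (IsLipschitzCylinder)
open Summit.Ventures.YMGap
open Summit.Ventures.YMGap.RobustBall

/-- **T49a_SU2BoundaryRateBall — `SU(2)`, every `d ≥ 1`, HYPOTHESIS-FREE, UNIFORMLY ON THE TIER-1 BALL** (Wilson units, 't Hooft `β_W/4`):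
if `2(d−1)|β_W| e^{ε₀} + e^{ε₀/2} √(2/3) ε₁ ≤ ρ < 1` then for EVERY member `(W, supp)` of `MemBallZd ε₀ ε₁ R`, EVERY DLR state `μ` of the
member, EVERY finite link volume `Λ`, EVERY boundary field `η`, every Lipschitz cylinder `F` (constant `K`, links `Δ`) and every `D`
with all links of `Δ` at base-point `ℓ^∞`-distance `≥ D` from every link outside `Λ`:
`|∫ F dγ^W_Λ(· | η) − ∫ F dμ| ≤ 2√2 · K · #Δ · max(ρ, ½)^{⌊D / max(1, R)⌋}` (`RobustBall.su2_abs_boundary_sub_integral_le`, BoundaryDecayBall). -/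
def T49a_SU2BoundaryRateBall : Prop :=
  ∀ (d : ℕ), 1 ≤ d → ∀ (βW ε₀ ε₁ ρ R : ℝ),
    2 * ((d : ℝ) - 1) * |βW| * Real.exp ε₀ + Real.exp (ε₀ / 2) * Real.sqrt (2 / 3) * ε₁ ≤ ρ → ρ < 1 →
    ∀ (W : Potential (ZdEdge d) (Matrix.specialUnitaryGroup (Fin 2) ℂ)) (supp : Finset (ZdEdge d) → Finset (Finset (ZdEdge d))),
      MemBallZd ε₀ ε₁ R W supp →
      ∀ μ ∈ perturbedGibbsMeasures (d := d) (fundamentalRep (Fin 2)) ((2 : ℕ) * (βW / 4)) W supp,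
      ∀ (Λ : Finset (ZdEdge d)) (η : LGConfig d (Matrix.specialUnitaryGroup (Fin 2) ℂ))
        (F : LGConfig d (Matrix.specialUnitaryGroup (Fin 2) ℂ) → ℝ) (Δ : Finset (ZdEdge d)) (K : ℝ≥0),
        IsLipschitzCylinder (fundamentalRep (Fin 2)) F Δ K → ∀ D : ℝ, (∀ y ∈ Δ, ∀ z, z ∉ Λ → D ≤ ‖y.1 - z.1‖) →
          |(∫ U, F U ∂(perturbedYM (d := d) (fundamentalRep (Fin 2)) ((2 : ℕ) * (βW / 4)) W supp Λ η)) - ∫ U, F U ∂μ| ≤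
            2 * Real.sqrt 2 * K * Δ.card * (max ρ (1 / 2)) ^ ⌊D / max 1 R⌋₊

/-- T49a_SU2BoundaryRateBall holds. -/
theorem T49a_SU2BoundaryRateBall_holds : T49a_SU2BoundaryRateBall :=
  fun _ hd _ _ _ _ _ hρ hρ1 _ _ hmem _ hμ Λ η _ _ _ hF _ hD => su2_abs_boundary_sub_integral_le hd hρ hρ1 hmem hμ Λ η hF hD

/-- **T49b_SUNBoundaryRateBall — every `N ≥ 2`, every `d ≥ 1`, HYPOTHESIS-FREE (Bakry–Émery pair)**: with `b = 2(d−1)|β| < 1/2` and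
`6(d−1)|β| e^{ε₀}/(1/2 − b) + e^{ε₀/2} ε₁/√(N(1/2 − b)) ≤ ρ < 1`, for every member of `MemBallZd ε₀ ε₁ R`, every DLR state, volume, boundary
field and Lipschitz cylinder at depth `D`: `|∫ F dγ^W_Λ(·|η) − ∫ F dμ| ≤ 2√N · K · #Δ · max(ρ,½)^{⌊D/max(1,R)⌋}`
(`RobustBall.suN_abs_boundary_sub_integral_le_bakryEmery`). -/
def T49b_SUNBoundaryRateBall : Prop :=
  ∀ (d N : ℕ), 1 ≤ d → 2 ≤ N → ∀ (β ε₀ ε₁ ρ R : ℝ), |β| * (2 * ((d : ℝ) - 1)) < 1 / 2 →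
    6 * ((d : ℝ) - 1) * |β| * Real.exp ε₀ / (1 / 2 - |β| * (2 * ((d : ℝ) - 1))) +
      Real.exp (ε₀ / 2) * ε₁ / Real.sqrt ((N : ℝ) * (1 / 2 - |β| * (2 * ((d : ℝ) - 1)))) ≤ ρ → ρ < 1 →
    ∀ (W : Potential (ZdEdge d) (Matrix.specialUnitaryGroup (Fin N) ℂ)) (supp : Finset (ZdEdge d) → Finset (Finset (ZdEdge d))),
      MemBallZd ε₀ ε₁ R W supp →
      ∀ μ ∈ perturbedGibbsMeasures (d := d) (fundamentalRep (Fin N)) (N * β) W supp,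
      ∀ (Λ : Finset (ZdEdge d)) (η : LGConfig d (Matrix.specialUnitaryGroup (Fin N) ℂ))
        (F : LGConfig d (Matrix.specialUnitaryGroup (Fin N) ℂ) → ℝ) (Δ : Finset (ZdEdge d)) (K : ℝ≥0),
        IsLipschitzCylinder (fundamentalRep (Fin N)) F Δ K → ∀ D : ℝ, (∀ y ∈ Δ, ∀ z, z ∉ Λ → D ≤ ‖y.1 - z.1‖) →
          |(∫ U, F U ∂(perturbedYM (d := d) (fundamentalRep (Fin N)) (N * β) W supp Λ η)) - ∫ U, F U ∂μ| ≤
            2 * Real.sqrt N * K * Δ.card * (max ρ (1 / 2)) ^ ⌊D / max 1 R⌋₊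

/-- T49b_SUNBoundaryRateBall holds. -/
theorem T49b_SUNBoundaryRateBall_holds : T49b_SUNBoundaryRateBall :=
  fun _ _ hd hN _ _ _ _ _ hb hρ hρ1 _ _ hmem _ hμ Λ η _ _ _ hF _ hD =>
    suN_abs_boundary_sub_integral_le_bakryEmery hd hN hb hρ hρ1 hmem hμ Λ η hF hD

/-- **T49c_SU2WilsonBoundaryRate — the Wilson point on `ℤ⁴` (pair door)**: for `0 ≤ β_W ≤ 1/12`, EVERY DLR state `μ` of `SU(2)` lattice
Yang–Mills (tree coupling `β_W/2`) and every finite-volume Wilson distribution `γ_Λ(· | η)` with ANY boundary field satisfy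
`|∫ F dγ_Λ(·|η) − ∫ F dμ| ≤ 2√2 · K · #Δ · (1/2)^{⌊D⌋}` on Lipschitz cylinders at depth `D`; for `1/12 ≤ β_W < 1/6` the ratio is `6β_W`
(`RobustBall.su2_wilson_boundary_upTo_oneTwelfth`, `su2_wilson_boundary_lt_oneSixth`; the quarter door pushes `1/12 ↦ 1/9`, `1/6 ↦ 2/9`:
`BoundaryDecayKR.lean`). -/
def T49c_SU2WilsonBoundaryRate : Prop :=
  (∀ βW : ℝ, 0 ≤ βW → βW ≤ 1 / 12 →
    ∀ μ ∈ ymGibbsMeasures (d := 4) (fundamentalRep (Fin 2)) (βW / 2),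
    ∀ (Λ : Finset (ZdEdge 4)) (η : LGConfig 4 (Matrix.specialUnitaryGroup (Fin 2) ℂ))
      (F : LGConfig 4 (Matrix.specialUnitaryGroup (Fin 2) ℂ) → ℝ) (Δ : Finset (ZdEdge 4)) (K : ℝ≥0),
      IsLipschitzCylinder (fundamentalRep (Fin 2)) F Δ K → ∀ D : ℝ, (∀ y ∈ Δ, ∀ z, z ∉ Λ → D ≤ ‖y.1 - z.1‖) →
        |(∫ U, F U ∂(ymSpecification (d := 4) (fundamentalRep (Fin 2)) (βW / 2) Λ η)) - ∫ U, F U ∂μ| ≤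
          2 * Real.sqrt 2 * K * Δ.card * (1 / 2 : ℝ) ^ ⌊D⌋₊) ∧
  (∀ βW : ℝ, 1 / 12 ≤ βW → βW < 1 / 6 →
    ∀ μ ∈ ymGibbsMeasures (d := 4) (fundamentalRep (Fin 2)) (βW / 2),
    ∀ (Λ : Finset (ZdEdge 4)) (η : LGConfig 4 (Matrix.specialUnitaryGroup (Fin 2) ℂ))
      (F : LGConfig 4 (Matrix.specialUnitaryGroup (Fin 2) ℂ) → ℝ) (Δ : Finset (ZdEdge 4)) (K : ℝ≥0),
      IsLipschitzCylinder (fundamentalRep (Fin 2)) F Δ K → ∀ D : ℝ, (∀ y ∈ Δ, ∀ z, z ∉ Λ → D ≤ ‖y.1 - z.1‖) →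
        |(∫ U, F U ∂(ymSpecification (d := 4) (fundamentalRep (Fin 2)) (βW / 2) Λ η)) - ∫ U, F U ∂μ| ≤
          2 * Real.sqrt 2 * K * Δ.card * (6 * βW) ^ ⌊D⌋₊)

/-- T49c_SU2WilsonBoundaryRate holds. -/
theorem T49c_SU2WilsonBoundaryRate_holds : T49c_SU2WilsonBoundaryRate :=
  ⟨fun _ h0 h _ hμ Λ η _ _ _ hF _ hD => su2_wilson_boundary_upTo_oneTwelfth h0 h hμ Λ η hF hD,
    fun _ h0 h _ hμ Λ η _ _ _ hF _ hD => su2_wilson_boundary_lt_oneSixth h0 h hμ Λ η hF hD⟩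

/-- **T49 — track Y2 / Wilson action: ONE STATE AT A RATE — exponential insensitivity to the boundary condition, HYPOTHESIS-FREE** (seat ds-3 g12 texts `HOME/ds/ds3/lean/g12/texts/V1XConjunctsDS3g12.lean` PART A VERBATIM as the parts above): inside the single-link doors, for every member of the tier-1 ball (and the Wilson action), every DLR state, every finite volume and EVERY boundary field, the finite-volume expectation of a Lipschitz cylinder at depth `D` differs from the infinite-volume one by `≤ 2√2·K·#Δ·max(ρ,½)^{⌊D/max(1,R)⌋}` (`SU(2)` every `d`; every `N` via Bakry–Émery; the Wilson point on `ℤ⁴`: `(1/2)^{⌊D⌋}` for `β_W ≤ 1/12`, `(6β_W)^{⌊D⌋}` below `1/6`). HONEST LABEL: a Dobrushin-comparison LOWER bound on the inverse penetration depth (vanishes linearly at the door's threshold, divided by the range); lattice strong coupling; nothing continuum. -/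
def T49_OneStateBoundaryRate : Prop :=
  T49a_SU2BoundaryRateBall ∧ T49b_SUNBoundaryRateBall ∧ T49c_SU2WilsonBoundaryRate

/-- T49 holds (the parts above, each closed by the owner's tree theorem). -/
theorem T49_OneStateBoundaryRate_holds : T49_OneStateBoundaryRate :=
  ⟨T49a_SU2BoundaryRateBall_holds, T49b_SUNBoundaryRateBall_holds, T49c_SU2WilsonBoundaryRate_holds⟩

end T49sec

section T50sec

open MeasureTheory Filter Topology
open Literature.Probability.LatticeModels hiding configShift configShift_apply
open Literature.MathematicalPhysics.QuantumLattice (fundamentalRep ZdEdge LGConfig ymSpecification ymGibbsMeasures configShift)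
open Summit.Ventures.YMGap
open Summit.Ventures.YMGap.RobustBall
open scoped NNReal
open Literature.MathematicalPhysics.QuantumLattice (fundamentalRep ZdEdge LGConfig ymGibbsMeasures)
open Literature.MathematicalPhysics.QuantumFieldTheory (IsLipschitzCylinder)

/-- **T50a_WilsonOneStateTailTrivial — WILSON, every `d ≥ 1`, every `N`**: under `MassGapAt d N β` there is ONE DLR state `μ`
(`ymGibbsMeasures = {μ}`), it is TAIL TRIVIAL, has SHORT-RANGE CORRELATIONS FOR ALL EVENTS (`∀ A, ∀ ε > 0, ∃ Λ` finite, `∀ B ∈ 𝓕_{Λᶜ}`: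
`|μ(A ∩ B) − μ(A) μ(B)| ≤ ε`), and is ERGODIC under every translation `θ_v`, `v ≠ 0` (`θ_v⁻¹ A = A ⇒ μ(A) ∈ {0,1}`)
(`RobustBall.oneState_tailTrivial_of_massGapAt`, OneStateTailTrivial). -/
def T50a_WilsonOneStateTailTrivial : Prop :=
  ∀ (d N : ℕ) [NeZero d] (β : ℝ), MassGapAt d N β →
    ∃ μ : Measure (LGConfig d (Matrix.specialUnitaryGroup (Fin N) ℂ)),
      ymGibbsMeasures (d := d) (fundamentalRep (Fin N)) ((N : ℝ) * β) = {μ} ∧ IsTailTrivial μ ∧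
      (∀ A : Set (LGConfig d (Matrix.specialUnitaryGroup (Fin N) ℂ)), MeasurableSet A → ∀ ε : ℝ, 0 < ε →
        ∃ Λ : Finset (ZdEdge d), ∀ B : Set (LGConfig d (Matrix.specialUnitaryGroup (Fin N) ℂ)),
          MeasurableSet[cylinderEvents (X := fun _ : ZdEdge d => Matrix.specialUnitaryGroup (Fin N) ℂ) ((↑Λ : Set (ZdEdge d))ᶜ)] B →
            |μ.real (A ∩ B) - μ.real A * μ.real B| ≤ ε) ∧
      ∀ v : Site d, v ≠ 0 → ∀ A : Set (LGConfig d (Matrix.specialUnitaryGroup (Fin N) ℂ)), MeasurableSet A →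
        (configShift v) ⁻¹' A = A → μ A = 0 ∨ μ A = 1

/-- T50a_WilsonOneStateTailTrivial holds. -/
theorem T50a_WilsonOneStateTailTrivial_holds : T50a_WilsonOneStateTailTrivial :=
  fun _ _ _ _ hgap => oneState_tailTrivial_of_massGapAt hgap

/-- **T50b_SU2OneStateTailTrivial — `SU(2)` on `ℤ⁴`, every tree coupling `|b| ≤ 9/50` (Wilson `|β_W| ≤ 9/25`)**: the one state is tail
trivial, short-range for all events, ergodic under every non-zero translation (`RobustBall.su2_wilson_oneState_tailTrivial`). -/
def T50b_SU2OneStateTailTrivial : Prop :=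
  ∀ b : ℝ, |b| ≤ 9 / 50 →
    ∃ μ : Measure (LGConfig 4 (Matrix.specialUnitaryGroup (Fin 2) ℂ)),
      ymGibbsMeasures (d := 4) (fundamentalRep (Fin 2)) b = {μ} ∧ IsTailTrivial μ ∧
      (∀ A : Set (LGConfig 4 (Matrix.specialUnitaryGroup (Fin 2) ℂ)), MeasurableSet A → ∀ ε : ℝ, 0 < ε →
        ∃ Λ : Finset (ZdEdge 4), ∀ B : Set (LGConfig 4 (Matrix.specialUnitaryGroup (Fin 2) ℂ)),
          MeasurableSet[cylinderEvents (X := fun _ : ZdEdge 4 => Matrix.specialUnitaryGroup (Fin 2) ℂ) ((↑Λ : Set (ZdEdge 4))ᶜ)] B →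
            |μ.real (A ∩ B) - μ.real A * μ.real B| ≤ ε) ∧
      ∀ v : Site 4, v ≠ 0 → ∀ A : Set (LGConfig 4 (Matrix.specialUnitaryGroup (Fin 2) ℂ)), MeasurableSet A →
        (configShift v) ⁻¹' A = A → μ A = 0 ∨ μ A = 1

/-- T50b_SU2OneStateTailTrivial holds. -/
theorem T50b_SU2OneStateTailTrivial_holds : T50b_SU2OneStateTailTrivial :=
  fun _ h => su2_wilson_oneState_tailTrivial h

/-- **T50c_SU2LocalDLRRate — `SU(2)`, every `d ≥ 1`, HYPOTHESIS-FREE, ON THE TIER-1 BALL** (Wilson units, 't Hooft `β_W/4`): if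
`2(d−1)|β_W| e^{ε₀} + e^{ε₀/2} √(2/3) ε₁ ≤ ρ < 1` then for every member `(W, supp)` of `MemBallZd ε₀ ε₁ R`, every DLR state `μ`, every
PROBABILITY MEASURE `ν` satisfying the member's single-link DLR equations at the links of `Λ` (`ν ∘ γ^W_{x} = ν`, `x ∈ Λ`), and every Lipschitz
cylinder `F` (constant `K`, links `Δ` at depth `≥ D` in `Λ`), with `ρ' = max(ρ, ½)`:
`|∫ F dν − ∫ F dμ| ≤ (2√2/(1 − ρ')) · K · #Δ · ρ'^{⌊D / max(1,R)⌋}` (`RobustBall.su2_abs_integral_sub_integral_le_of_localDLR`). -/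
def T50c_SU2LocalDLRRate : Prop :=
  ∀ (d : ℕ), 1 ≤ d → ∀ (βW ε₀ ε₁ ρ R : ℝ),
    2 * ((d : ℝ) - 1) * |βW| * Real.exp ε₀ + Real.exp (ε₀ / 2) * Real.sqrt (2 / 3) * ε₁ ≤ ρ → ρ < 1 →
    ∀ (W : Potential (ZdEdge d) (Matrix.specialUnitaryGroup (Fin 2) ℂ)) (supp : Finset (ZdEdge d) → Finset (Finset (ZdEdge d))),
      MemBallZd ε₀ ε₁ R W supp →
      ∀ μ ∈ perturbedGibbsMeasures (d := d) (fundamentalRep (Fin 2)) ((2 : ℕ) * (βW / 4)) W supp,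
      ∀ (ν : Measure (LGConfig d (Matrix.specialUnitaryGroup (Fin 2) ℂ))) [IsProbabilityMeasure ν] (Λ : Finset (ZdEdge d)),
        (∀ x ∈ Λ, ν.bind (perturbedYM (d := d) (fundamentalRep (Fin 2)) ((2 : ℕ) * (βW / 4)) W supp {x}) = ν) →
      ∀ (F : LGConfig d (Matrix.specialUnitaryGroup (Fin 2) ℂ) → ℝ) (Δ : Finset (ZdEdge d)) (K : ℝ≥0),
        IsLipschitzCylinder (fundamentalRep (Fin 2)) F Δ K → ∀ D : ℝ, (∀ y ∈ Δ, ∀ z, z ∉ Λ → D ≤ ‖y.1 - z.1‖) →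
          |(∫ U, F U ∂ν) - ∫ U, F U ∂μ| ≤
            2 * Real.sqrt 2 / (1 - max ρ (1 / 2)) * K * Δ.card * (max ρ (1 / 2)) ^ ⌊D / max 1 R⌋₊

/-- T50c_SU2LocalDLRRate holds. -/
theorem T50c_SU2LocalDLRRate_holds : T50c_SU2LocalDLRRate :=
  fun _ hd _ _ _ _ _ hρ hρ1 _ _ hmem _ hμ ν _ Λ hν _ _ _ hF _ hD =>
    su2_abs_integral_sub_integral_le_of_localDLR hd hρ hρ1 hmem hμ ν Λ hν hF hD

/-- **T50d_SU2WilsonLocalPerturbation — THE WILSON POINT, `SU(2)` on `ℤ⁴`, `0 ≤ β_W ≤ 1/12`**: for ANY DLR state `μ` of the Wilson action (tree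
coupling `β_W/2`), ANY continuous finite-range perturbation `(W', supp')` (terms reading their own links, locally finite support, NO smallness)
with no term through a link of `Λ` (`hamiltonianIn W' supp' {x} = 0`, `x ∈ Λ`), ANY DLR state `ν` of the perturbed action, and every Lipschitz
cylinder at depth `≥ D` in `Λ`: `|∫ F dν − ∫ F dμ| ≤ 4√2 · K · #Δ · (1/2)^{⌊D⌋}` (`RobustBall.su2_wilson_localPerturbation_upTo_oneTwelfth`). -/
def T50d_SU2WilsonLocalPerturbation : Prop :=
  ∀ (βW : ℝ), 0 ≤ βW → βW ≤ 1 / 12 →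
    ∀ μ ∈ ymGibbsMeasures (d := 4) (fundamentalRep (Fin 2)) (βW / 2),
    ∀ (W' : Potential (ZdEdge 4) (Matrix.specialUnitaryGroup (Fin 2) ℂ)) (supp' : Finset (ZdEdge 4) → Finset (Finset (ZdEdge 4))),
      (∀ X, Continuous (W' X)) → (∀ X, DependsOn (W' X) (↑X : Set (ZdEdge 4))) → W'.IsSupportedBy supp' →
      ∀ ν ∈ perturbedGibbsMeasures (d := 4) (fundamentalRep (Fin 2)) (βW / 2) W' supp',
      ∀ (Λ : Finset (ZdEdge 4)), (∀ x ∈ Λ, hamiltonianIn W' supp' {x} = 0) →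
      ∀ (F : LGConfig 4 (Matrix.specialUnitaryGroup (Fin 2) ℂ) → ℝ) (Δ : Finset (ZdEdge 4)) (K : ℝ≥0),
        IsLipschitzCylinder (fundamentalRep (Fin 2)) F Δ K → ∀ D : ℝ, (∀ y ∈ Δ, ∀ z, z ∉ Λ → D ≤ ‖y.1 - z.1‖) →
          |(∫ U, F U ∂ν) - ∫ U, F U ∂μ| ≤ 4 * Real.sqrt 2 * K * Δ.card * (1 / 2 : ℝ) ^ ⌊D⌋₊

/-- T50d_SU2WilsonLocalPerturbation holds. -/
theorem T50d_SU2WilsonLocalPerturbation_holds : T50d_SU2WilsonLocalPerturbation :=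
  fun _ h0 h _ hμ _ _ hW'c hW'dep hsupp' _ hν Λ hfree _ _ _ hF _ hD =>
    su2_wilson_localPerturbation_upTo_oneTwelfth h0 h hμ hW'c hW'dep hsupp' hν Λ hfree hF hD

/-- **T50 — track Y2 / Wilson action: THE ONE STATE IS TAIL TRIVIAL, SHORT-RANGE, ERGODIC, AND LOCAL IN THE ACTION, HYPOTHESIS-FREE** (seat ds-3 g12 texts PART C + PART E VERBATIM as the parts above): (C) every `d`, `N`, `β` under `MassGapAt`: the unique DLR state is tail trivial, has short-range correlations for ALL events and is ergodic under every non-zero translation; `SU(2)` instance `|b| ≤ 9/50`; (E) locality: the DLR state of a local perturbation of the action differs from the unperturbed one on far-away cylinders at the clustering rate (`SU(2)` `ℤ⁴`, `β_W ≤ 1/12`), and the Wilson-point form. HONEST LABEL: lattice strong coupling; rates are door artefacts; nothing continuum. -/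
def T50_OneStateTailTrivialLocal : Prop :=
  T50a_WilsonOneStateTailTrivial ∧ T50b_SU2OneStateTailTrivial ∧ T50c_SU2LocalDLRRate ∧ T50d_SU2WilsonLocalPerturbation

/-- T50 holds (the parts above, each closed by the owner's tree theorem). -/
theorem T50_OneStateTailTrivialLocal_holds : T50_OneStateTailTrivialLocal :=
  ⟨T50a_WilsonOneStateTailTrivial_holds, T50b_SU2OneStateTailTrivial_holds, T50c_SU2LocalDLRRate_holds,
    T50d_SU2WilsonLocalPerturbation_holds⟩

end T50sec

end Summit.Ventures.YMGap

end
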